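import Mathlib
import HarnessLib

/-!
# K3 VL child `KLRegimeVolumeLimitV17F2` (stmt-HubbardSuperconductivity-20440), located item #23 «W2-HALF-VL», COV/SEC shallow half, sectional brick S5:
# the SCALAR REDUCTION of the sectional telescope step — the ε-free prefactor `(Λ_mβ/π + 3)·√(24·L²·N̄_cell)·(βL²)⁻²·4βL²/Λ` is `β`-, `L`-free

Cell `gate-hubbard-kl`, seat p3 (g16), lead of #23.  Pure real arithmetic for the sectional (fixed-time) pieces of the frame telescope: the cell-count radical
`√(24·L²·((√2·L·a/π + 2)(√2·L·b/π + 2))) ≤ L²·√(24·((√2·a/π + 2)(√2·b/π + 2)))` (`L ≥ 1`), and the two step bounds — family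
(`x²·𝔅₀(x) ≤ C₁G₀5Λ_m`) and covariance (`A₀^♯(x) ≤ (G₀/x²)/(βL²Λ²)·𝒜`, `√Ŵ(x) ≤ x·√Ŵ`) — in the form `≤ 𝒦·G₀/(Λ²·x)` with `𝒦` free of `β ≥ 128`,
`L`, `x`.  No definitions, no sorry. [folklore]
-/

noncomputable section

namespace Summit.HubbardSuperconductivity.HubbardSuperconductivity.Theorems.TorusFourierL2

set_option linter.dupNamespace false -- summit = problem name (single-conjunct summit), D-0017

open scoped Real

/-- **Dropping a nonnegative second summand** (the sectional amplitude is the full one minus its time term). [folklore] -/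
theorem le_of_add_six_le {a T b₁ b₂ b₃ b₄ r : ℝ} (h : a + T + b₁ + b₂ + b₃ + b₄ ≤ r) (hT : 0 ≤ T) : a + b₁ + b₂ + b₃ + b₄ ≤ r := by linarith

/-- **The sectional cell-count radical is `≤ L²·√(24·c_N)`** for `L ≥ 1`, `a, b ≥ 0`. [folklore] -/
theorem sqrt_secCellCount_le {L a b : ℝ} (hL : 1 ≤ L) (ha : 0 ≤ a) (hb : 0 ≤ b) :
    Real.sqrt (24 * L ^ 2 * ((Real.sqrt 2 * L * a / π + 2) * (Real.sqrt 2 * L * b / π + 2))) ≤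
      L ^ 2 * Real.sqrt (24 * ((Real.sqrt 2 * a / π + 2) * (Real.sqrt 2 * b / π + 2))) := by
  have hπ := Real.pi_pos
  have hL0 : 0 ≤ L := zero_le_one.trans hL
  have h1 : Real.sqrt 2 * L * a / π + 2 ≤ L * (Real.sqrt 2 * a / π + 2) := by
    rw [mul_add]
    have : Real.sqrt 2 * L * a / π = L * (Real.sqrt 2 * a / π) := by ring
    rw [this]
    nlinarith only [hL]
  have h2 : Real.sqrt 2 * L * b / π + 2 ≤ L * (Real.sqrt 2 * b / π + 2) := by
    rw [mul_add]
    have : Real.sqrt 2 * L * b / π = L * (Real.sqrt 2 * b / π) := by ring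
    rw [this]
    nlinarith only [hL]
  have h12 : (Real.sqrt 2 * L * a / π + 2) * (Real.sqrt 2 * L * b / π + 2) ≤ (L * (Real.sqrt 2 * a / π + 2)) * (L * (Real.sqrt 2 * b / π + 2)) :=
    mul_le_mul h1 h2 (by positivity) (by positivity)
  calc Real.sqrt (24 * L ^ 2 * ((Real.sqrt 2 * L * a / π + 2) * (Real.sqrt 2 * L * b / π + 2)))
      ≤ Real.sqrt (24 * L ^ 2 * ((L * (Real.sqrt 2 * a / π + 2)) * (L * (Real.sqrt 2 * b / π + 2)))) :=
        Real.sqrt_le_sqrt (mul_le_mul_of_nonneg_left h12 (by positivity))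
    _ = Real.sqrt ((L ^ 2) ^ 2 * (24 * ((Real.sqrt 2 * a / π + 2) * (Real.sqrt 2 * b / π + 2)))) := by ring_nf
    _ = L ^ 2 * Real.sqrt (24 * ((Real.sqrt 2 * a / π + 2) * (Real.sqrt 2 * b / π + 2))) := by
        rw [Real.sqrt_mul (by positivity), Real.sqrt_sq (by positivity)]

/-- **The ε-free prefactor**: `(Λ_mβ/π + 3)·(L²·(βL²)⁻²·(4βL²/Λ)) ≤ 4/Λ` for `β ≥ 128`, `0 < Λ_m ≤ 1`, `L > 0` (`Λ_m/π + 3/β ≤ 1`). [folklore] -/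
theorem secPrefactor_le {lam β L Λ : ℝ} (hlam0 : 0 ≤ lam) (hlam1 : lam ≤ 1) (hβ : 128 ≤ β) (hL : 0 < L) (hΛ : 0 < Λ) :
    (lam * β / π + 3) * (L ^ 2 * ((1 / (β * L ^ 2)) ^ 2 * (4 * (β * L ^ 2) / Λ))) ≤ 4 / Λ := by
  have hπ3 := Real.pi_gt_three
  have hβ0 : 0 < β := by linarith
  have e : (lam * β / π + 3) * (L ^ 2 * ((1 / (β * L ^ 2)) ^ 2 * (4 * (β * L ^ 2) / Λ))) = (lam / π + 3 / β) * (4 / Λ) := by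
    field_simp
  rw [e]
  have h1 : lam / π + 3 / β ≤ 1 := by
    have a1 : lam / π ≤ 1 / 3 := by rw [div_le_div_iff₀ (by linarith) (by norm_num)]; nlinarith
    have a2 : 3 / β ≤ 3 / 128 := div_le_div_of_nonneg_left (by norm_num) (by norm_num) hβ
    linarith
  calc (lam / π + 3 / β) * (4 / Λ) ≤ 1 * (4 / Λ) := mul_le_mul_of_nonneg_right h1 (by positivity)
    _ = 4 / Λ := one_mul _

/-- **The sectional FAMILY step scalar**: with `x²·𝔅₀ ≤ C₁·(G₀·(5Λ_m))`, `C₁ = d e₀²/Λ_m²`, `N_s ≤ L²·√(24 c_N)`, `β ≥ 128`: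
`(Λ_mβ/π + 3)·(x·W·N_s·(𝔅₀·((βL²)⁻²·(4βL²/Λ)))) ≤ (20·W·√(24 c_N)·d·e₀²)·G₀/(Λ_m·Λ·x)`. [folklore] -/
theorem secFam_scalar_le {lam β L Λ x W Ns cN d e₀ G₀ B₀x : ℝ} (hlam : 0 < lam) (hlam1 : lam ≤ 1) (hβ : 128 ≤ β) (hL : 1 ≤ L) (hΛ : 0 < Λ)
    (hx : 1 ≤ x) (hW : 0 ≤ W) (hNs0 : 0 ≤ Ns) (hNs : Ns ≤ L ^ 2 * Real.sqrt (24 * cN)) (hd : 0 ≤ d) (hG₀ : 0 ≤ G₀)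
    (hB₀x : x ^ 2 * B₀x ≤ d * e₀ ^ 2 / lam ^ 2 * (G₀ * (5 * lam))) :
    (lam * β / π + 3) * (x * W * Ns * (B₀x * ((1 / (β * L ^ 2)) ^ 2 * (4 * (β * L ^ 2) / Λ)))) ≤
      (20 * W * Real.sqrt (24 * cN) * d * e₀ ^ 2) * G₀ / (lam * Λ * x) := by
  have hπ := Real.pi_pos
  have hL0 : 0 < L := lt_of_lt_of_le one_pos hL
  have hx0 : 0 < x := lt_of_lt_of_le one_pos hx
  have hβ0 : 0 < β := by linarith
  have hpre := secPrefactor_le hlam.le hlam1 hβ hL0 hΛ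
  have hxB : x * B₀x ≤ 5 * d * e₀ ^ 2 * G₀ / (lam * x) := by
    rw [le_div_iff₀ (by positivity)]
    have e : d * e₀ ^ 2 / lam ^ 2 * (G₀ * (5 * lam)) = 5 * d * e₀ ^ 2 * G₀ / lam := by field_simp
    calc x * B₀x * (lam * x) = lam * (x ^ 2 * B₀x) := by ring
      _ ≤ lam * (5 * d * e₀ ^ 2 * G₀ / lam) := by rw [← e]; exact mul_le_mul_of_nonneg_left hB₀x hlam.le
      _ = 5 * d * e₀ ^ 2 * G₀ := by field_simp
  calc (lam * β / π + 3) * (x * W * Ns * (B₀x * ((1 / (β * L ^ 2)) ^ 2 * (4 * (β * L ^ 2) / Λ))))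
      = W * (x * B₀x) * (Ns / L ^ 2) * ((lam * β / π + 3) * (L ^ 2 * ((1 / (β * L ^ 2)) ^ 2 * (4 * (β * L ^ 2) / Λ)))) := by
        field_simp
    _ ≤ W * (5 * d * e₀ ^ 2 * G₀ / (lam * x)) * Real.sqrt (24 * cN) * (4 / Λ) := by
        have hN' : Ns / L ^ 2 ≤ Real.sqrt (24 * cN) := by rw [div_le_iff₀ (by positivity)]; linarith
        gcongr
    _ = (20 * W * Real.sqrt (24 * cN) * d * e₀ ^ 2) * G₀ / (lam * Λ * x) := by field_simp; ring

/-- **The sectional COVARIANCE step scalar**: with `A₀^♯ ≤ (G₀/x²)/((βL²)·Λ²)·𝒜`, `W_x ≤ x·W`, `N_s ≤ L²·√(24 c_N)`, `β ≥ 128`, `Λ ≤ 1`: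
`(Λ_mβ/π + 3)·(W_x·N_s·A₀^♯) ≤ (W·√(24 c_N)·𝒜)·G₀/(Λ²·x)`. [folklore] -/
theorem secCov_scalar_le {lam β L Λ x W Wx Ns cN G₀ AΔs 𝒜 : ℝ} (hlam : 0 < lam) (hlam1 : lam ≤ 1) (hβ : 128 ≤ β) (hL : 1 ≤ L) (hΛ : 0 < Λ)
    (hx : 1 ≤ x) (hW : 0 ≤ W) (hWx0 : 0 ≤ Wx) (hWx : Wx ≤ x * W) (hNs0 : 0 ≤ Ns) (hNs : Ns ≤ L ^ 2 * Real.sqrt (24 * cN))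
    (hG₀ : 0 ≤ G₀) (h𝒜 : 0 ≤ 𝒜) (hAΔ : AΔs ≤ (G₀ / x ^ 2) / ((β * L ^ 2) * Λ ^ 2) * 𝒜) :
    (lam * β / π + 3) * (Wx * Ns * AΔs) ≤ (W * Real.sqrt (24 * cN) * 𝒜) * G₀ / (Λ ^ 2 * x) := by
  have hπ := Real.pi_pos
  have hπ3 := Real.pi_gt_three
  have hL0 : 0 < L := lt_of_lt_of_le one_pos hL
  have hx0 : 0 < x := lt_of_lt_of_le one_pos hx
  have hβ0 : 0 < β := by linarith
  rcases le_or_gt 0 AΔs with hA0 | hneg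
  · have h1 : (lam * β / π + 3) * (Wx * Ns * AΔs) ≤ (lam * β / π + 3) * ((x * W) * (L ^ 2 * Real.sqrt (24 * cN)) * ((G₀ / x ^ 2) / ((β * L ^ 2) * Λ ^ 2) * 𝒜)) := by
      gcongr
    refine h1.trans ?_
    have e : (lam * β / π + 3) * ((x * W) * (L ^ 2 * Real.sqrt (24 * cN)) * ((G₀ / x ^ 2) / ((β * L ^ 2) * Λ ^ 2) * 𝒜)) =
        (lam / π + 3 / β) * ((W * Real.sqrt (24 * cN) * 𝒜) * G₀ / (Λ ^ 2 * x)) := by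
      field_simp
    rw [e]
    have h2 : lam / π + 3 / β ≤ 1 := by
      have a1 : lam / π ≤ 1 / 3 := by rw [div_le_div_iff₀ (by linarith) (by norm_num)]; nlinarith
      have a2 : 3 / β ≤ 3 / 128 := div_le_div_of_nonneg_left (by norm_num) (by norm_num) hβ
      linarith
    calc (lam / π + 3 / β) * ((W * Real.sqrt (24 * cN) * 𝒜) * G₀ / (Λ ^ 2 * x)) ≤ 1 * ((W * Real.sqrt (24 * cN) * 𝒜) * G₀ / (Λ ^ 2 * x)) :=
        mul_le_mul_of_nonneg_right h2 (by positivity)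
      _ = _ := one_mul _
  · have h1 : (lam * β / π + 3) * (Wx * Ns * AΔs) ≤ 0 :=
      mul_nonpos_of_nonneg_of_nonpos (by positivity) (mul_nonpos_of_nonneg_of_nonpos (by positivity) hneg.le)
    exact h1.trans (by positivity)

end Summit.HubbardSuperconductivity.HubbardSuperconductivity.Theorems.TorusFourierL2

end
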